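import Summits.NavierStokesRegularity.FunctionalMining.TopEigSaturatingSup
import HarnessLib

/-!
# FunctionalMining — the saturating law `T_LD` in one-sided-derivative-value form, and the `λ₁` / `−λ₃` rows given L-λ

Search for candidate a priori estimates; no regularity claim. Cell `pub-nsfunc`, prove seat
(gen 17). The dictionary's `SaturatingLaw F σ γ κ` (`Candidates.lean`) is an `IsRateBudget`: it
DEMANDS that `s ↦ F(u s)` be differentiable within the window at every time of every zero-mean
classical solution, and bounds `derivWithin`. For the smooth cores (`ℰ`, `∫|ω|^q`, `∫|S|^q`, `Ḣ^s`,
…) this clause is automatic; for the NON-SMOOTH spectral cores `∫(λ₁⁺)^q(S)`, `∫((−λ₃)⁺)^q(S)`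
(K0 `ES.lam1.q`, `ES.neglam3.q`) it is not supplied by the estimate (the moment is locally Lipschitz in
time and has one-sided derivatives, which can differ where `λ₁ = λ₂ > 0` on a set of positive measure).
This file types the law in the form the kernel theorem of `TopEigSaturatingSup` proves — the
ONE-SIDED-DERIVATIVE-VALUE form already used by the dictionary for the `T_C | C1` rows of the same
cores (`FunctionalRateSupBound`, `StrainEigen.lean`):

* `SaturatingLawSup F σ γ κ` — along every zero-mean classical solution of unforced Navier–Stokes
  (`ν > 0`) on `T³ × [a, b]`, every `R` with `HasDerivWithinAt (s ↦ F(u s)) R (Icc a b) t` obeys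
  `R ≤ κ ν^{−γ} (2ℰ(u t)) F(u t)^{1+1/σ}`;
* `SaturatingLaw.saturatingLawSup` (the `IsRateBudget` form implies it) and
  `SaturatingLawSup.saturatingLaw_of_differentiable` (conversely, given the differentiability clause);
* **`topEigMoment_saturatingLawSup_of_heatCoercivePos`**: for every real `q ≥ 2`,
  `TopEigHeatCoercivePos q → ∃ κ, SaturatingLawSup (∫(λ₁⁺)^q) (2q−3) ((3q−3)/(2q−3)) κ` — Theorem
  G (ii) of SIEVELD §3.4 closing the `ES.lam1.q | T_LD` rows in this form, conditionally on Lemma L-λ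
  only; `negBotEigMoment_saturatingLawSup_of_heatCoercivePos` for the `−λ₃` core.

[ours, bookkeeping + the gen-17 kernel theorem]
-/

noncomputable section

open MeasureTheory Set Filter Topology
open scoped InnerProductSpace RealInnerProductSpace

namespace Summit.NavierStokesRegularity.FunctionalMining

open Literature.Analysis.FunctionSpaces Literature.Analysis.FluidPDE

variable {d : Type*} [Fintype d] [DecidableEq d]

/-- **Saturating law `T_LD_κ(F; σ, γ)`, one-sided-derivative-value form.** For `d = 3`, along every
zero-mean classical solution of unforced Navier–Stokes (`ν > 0`) on `T³ × [a, b]`, at every `t ∈ [a, b]`,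
every one-sided derivative value `R` of `s ↦ F(u s)` within `[a, b]` at `t` satisfies
`R ≤ κ · ν^{−γ} · (2ℰ(u t)) · F(u t)^{1+1/σ}`. No differentiability is demanded (vacuous where no
derivative value exists); for functionals differentiable along solutions it is the dictionary's
`SaturatingLaw` (`SaturatingLaw.saturatingLawSup`, `SaturatingLawSup.saturatingLaw_of_differentiable`).
Search for candidate a priori estimates; no regularity claim — nothing is asserted. [ours, bookkeeping] -/
def SaturatingLawSup (F : (UnitAddTorus d → EuclideanSpace ℝ d) → ℝ) (σ γ κ : ℝ) : Prop :=
  Fintype.card d = 3 → ∀ ⦃ν : ℝ⦄, 0 < ν → ∀ ⦃a b : ℝ⦄, a < b →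
    ∀ ⦃u : ℝ → UnitAddTorus d → EuclideanSpace ℝ d⦄ ⦃p : ℝ → UnitAddTorus d → ℝ⦄,
      Torus.IsClassicalNSSolutionOn (Icc a b) ν 0 u p →
      (∀ t ∈ Icc a b, Torus.HasZeroMean (u t)) →
      ∀ t ∈ Icc a b, ∀ R : ℝ, HasDerivWithinAt (fun s => F (u s)) R (Icc a b) t →
        R ≤ κ * ν ^ (-γ) * (2 * torusEnstrophy (u t)) * F (u t) ^ (1 + σ⁻¹)

/-- The `IsRateBudget` form of the saturating law implies the one-sided-derivative-value form.
[ours, bookkeeping] -/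
theorem SaturatingLaw.saturatingLawSup {F : (UnitAddTorus d → EuclideanSpace ℝ d) → ℝ} {σ γ κ : ℝ}
    (h : SaturatingLaw (d := d) F σ γ κ) : SaturatingLawSup (d := d) F σ γ κ :=
  fun hd _ hν _ _ hab _ _ hsol hmean _ ht _ hR =>
    IsRateBudget.le_of_hasDerivWithinAt h hd hν hab hsol hmean ht hR

/-- Conversely, the one-sided-derivative-value form together with the differentiability of
`s ↦ F(u s)` within the window at every time of every zero-mean classical solution gives the
`IsRateBudget` form. [ours, bookkeeping] -/
theorem SaturatingLawSup.saturatingLaw_of_differentiable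
    {F : (UnitAddTorus d → EuclideanSpace ℝ d) → ℝ} {σ γ κ : ℝ} (h : SaturatingLawSup (d := d) F σ γ κ)
    (hdiff : ∀ ⦃ν : ℝ⦄, 0 < ν → ∀ ⦃a b : ℝ⦄, a < b →
      ∀ ⦃u : ℝ → UnitAddTorus d → EuclideanSpace ℝ d⦄ ⦃p : ℝ → UnitAddTorus d → ℝ⦄,
      Torus.IsClassicalNSSolutionOn (Icc a b) ν 0 u p → (∀ t ∈ Icc a b, Torus.HasZeroMean (u t)) →
      ∀ t ∈ Icc a b, DifferentiableWithinAt ℝ (fun s => F (u s)) (Icc a b) t) :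
    SaturatingLaw (d := d) F σ γ κ := by
  intro hd ν hν a b hab u p hsol hmean t ht
  have hdt := hdiff hν hab hsol hmean t ht
  exact ⟨hdt, h hd hν hab hsol hmean t ht _ hdt.hasDerivWithinAt⟩

/-- Larger `κ` is the weaker law, for a non-negative functional. [ours, bookkeeping] -/
theorem SaturatingLawSup.mono_kappa {F : (UnitAddTorus d → EuclideanSpace ℝ d) → ℝ} {σ γ κ κ' : ℝ}
    (h : SaturatingLawSup (d := d) F σ γ κ) (hF : ∀ v, 0 ≤ F v) (hκ : κ ≤ κ') :
    SaturatingLawSup (d := d) F σ γ κ' := by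
  intro hd ν hν a b hab u p hsol hmean t ht R hR
  have h1 := h hd hν hab hsol hmean t ht R hR
  have hx : 0 ≤ ν ^ (-γ) * (2 * torusEnstrophy (u t)) * F (u t) ^ (1 + σ⁻¹) :=
    mul_nonneg (mul_nonneg (Real.rpow_nonneg hν.le _)
      (mul_nonneg (by norm_num) (torusEnstrophy_nonneg _))) (Real.rpow_nonneg (hF _) _)
  calc R ≤ κ * ν ^ (-γ) * (2 * torusEnstrophy (u t)) * F (u t) ^ (1 + σ⁻¹) := h1
    _ = κ * (ν ^ (-γ) * (2 * torusEnstrophy (u t)) * F (u t) ^ (1 + σ⁻¹)) := by ring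
    _ ≤ κ' * (ν ^ (-γ) * (2 * torusEnstrophy (u t)) * F (u t) ^ (1 + σ⁻¹)) :=
        mul_le_mul_of_nonneg_right hκ hx
    _ = κ' * ν ^ (-γ) * (2 * torusEnstrophy (u t)) * F (u t) ^ (1 + σ⁻¹) := by ring

/-! ### The `λ₁` and `−λ₃` rows in this form, conditionally on Lemma L-λ only -/

/-- **Theorem G (ii), `λ₁` core (kernel): `TopEigHeatCoercivePos q → ∃ κ, SaturatingLawSup (∫(λ₁⁺)^q)
(2q−3) ((3q−3)/(2q−3)) κ`** for every real `q ≥ 2` — the K0 rows `ES.lam1.q | T_LD` (`q = 2, 3, 4`: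
`(σ, γ) = (1, 3), (3, 2), (5, 9/5)`) in one-sided-derivative-value form, conditional on Lemma L-λ(q)
alone (`TopEigSaturatingSup`). [ours] -/
theorem topEigMoment_saturatingLawSup_of_heatCoercivePos {q : ℝ} (hq : 2 ≤ q)
    (hL : TopEigHeatCoercivePos (d := Fin 3) q) :
    ∃ κ : ℝ, 0 ≤ κ ∧
      SaturatingLawSup (d := Fin 3) (torusTopEigMoment q) (2 * q - 3) ((3 * q - 3) / (2 * q - 3)) κ := by
  obtain ⟨c, hc, hLc⟩ := hL
  obtain ⟨κ, hκ0, hκ⟩ := TopEig.topEigMoment_rate_le_of_heatCoercive hq hc hLc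
  refine ⟨κ, hκ0, ?_⟩
  intro _ ν hν a b hab u p hsol hmean t ht R hR
  calc R ≤ κ * ν ^ (-((3 * q - 3) / (2 * q - 3))) *
        ((2 * torusEnstrophy (u t)) * torusTopEigMoment q (u t) ^ (1 + (2 * q - 3)⁻¹)) :=
        hκ hν hab hsol hmean t ht R hR
    _ = κ * ν ^ (-((3 * q - 3) / (2 * q - 3))) * (2 * torusEnstrophy (u t)) *
        torusTopEigMoment q (u t) ^ (1 + (2 * q - 3)⁻¹) := by ring

/-- **Theorem G (ii), `−λ₃` core (kernel): `NegBotEigHeatCoercivePos q → ∃ κ, SaturatingLawSup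
(∫((−λ₃)⁺)^q) (2q−3) ((3q−3)/(2q−3)) κ`** for every real `q ≥ 2` (rows `ES.neglam3.q | T_LD`). [ours] -/
theorem negBotEigMoment_saturatingLawSup_of_heatCoercivePos {q : ℝ} (hq : 2 ≤ q)
    (hL : NegBotEigHeatCoercivePos (d := Fin 3) q) :
    ∃ κ : ℝ, 0 ≤ κ ∧
      SaturatingLawSup (d := Fin 3) (torusNegBotEigMoment q) (2 * q - 3) ((3 * q - 3) / (2 * q - 3)) κ := by
  obtain ⟨c, hc, hLc⟩ := hL
  obtain ⟨κ, hκ0, hκ⟩ := TopEig.negBotEigMoment_rate_le_of_heatCoercive hq hc hLc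
  refine ⟨κ, hκ0, ?_⟩
  intro _ ν hν a b hab u p hsol hmean t ht R hR
  calc R ≤ κ * ν ^ (-((3 * q - 3) / (2 * q - 3))) *
        ((2 * torusEnstrophy (u t)) * torusNegBotEigMoment q (u t) ^ (1 + (2 * q - 3)⁻¹)) :=
        hκ hν hab hsol hmean t ht R hR
    _ = κ * ν ^ (-((3 * q - 3) / (2 * q - 3))) * (2 * torusEnstrophy (u t)) *
        torusNegBotEigMoment q (u t) ^ (1 + (2 * q - 3)⁻¹) := by ring

/-- **The typed dictionary implication, in this form:** for every real `q ≥ 2`,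
`TopEigHeatCoercivePos q → ∃ κ, SaturatingLawSup (∫(λ₁⁺)^q) (2q−3) ((3q−3)/(2q−3)) κ` and then the
law for all larger `κ` — the analogue of `topEigMomentSaturatingLaw_of_coercive` with the paper
implication `TopEigTLDOfCoercive` replaced by a kernel theorem. [ours] -/
theorem topEigMoment_saturatingLawSup_eventually {q : ℝ} (hq : 2 ≤ q)
    (hL : TopEigHeatCoercivePos (d := Fin 3) q) :
    ∃ κ₀ : ℝ, ∀ κ, κ₀ ≤ κ →
      SaturatingLawSup (d := Fin 3) (torusTopEigMoment q) (2 * q - 3) ((3 * q - 3) / (2 * q - 3)) κ := by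
  obtain ⟨κ₀, _, h⟩ := topEigMoment_saturatingLawSup_of_heatCoercivePos hq hL
  exact ⟨κ₀, fun κ hκ => h.mono_kappa (torusTopEigMoment_nonneg q) hκ⟩

/-- **The three dictionary rows `ES.lam1.q | T_LD | G1`, `q = 2, 3, 4`, in one-sided-derivative-value
form, each conditional on Lemma L-λ(q) only** (K0 exponents `(σ, γ) = (1, 3), (3, 2), (5, 9/5)`).
[ours] -/
theorem topEigMoment_saturatingLawSup_rows :
    (TopEigHeatCoercivePos (d := Fin 3) 2 →
      ∃ κ : ℝ, 0 ≤ κ ∧ SaturatingLawSup (d := Fin 3) (torusTopEigMoment 2) 1 3 κ) ∧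
    (TopEigHeatCoercivePos (d := Fin 3) 3 →
      ∃ κ : ℝ, 0 ≤ κ ∧ SaturatingLawSup (d := Fin 3) (torusTopEigMoment 3) 3 2 κ) ∧
    (TopEigHeatCoercivePos (d := Fin 3) 4 →
      ∃ κ : ℝ, 0 ≤ κ ∧ SaturatingLawSup (d := Fin 3) (torusTopEigMoment 4) 5 (9 / 5) κ) := by
  refine ⟨fun h => ?_, fun h => ?_, fun h => ?_⟩
  · have h2 := topEigMoment_saturatingLawSup_of_heatCoercivePos (q := 2) (by norm_num) h
    norm_num at h2; exact h2
  · have h3 := topEigMoment_saturatingLawSup_of_heatCoercivePos (q := 3) (by norm_num) h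
    norm_num at h3; exact h3
  · have h4 := topEigMoment_saturatingLawSup_of_heatCoercivePos (q := 4) (by norm_num) h
    norm_num at h4; exact h4

/-- **The three dictionary rows `ES.neglam3.q | T_LD | G1`, `q = 2, 3, 4`**, same form, each conditional
on Lemma L-λ(q) for the `−λ₃` core only. [ours] -/
theorem negBotEigMoment_saturatingLawSup_rows :
    (NegBotEigHeatCoercivePos (d := Fin 3) 2 →
      ∃ κ : ℝ, 0 ≤ κ ∧ SaturatingLawSup (d := Fin 3) (torusNegBotEigMoment 2) 1 3 κ) ∧
    (NegBotEigHeatCoercivePos (d := Fin 3) 3 →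
      ∃ κ : ℝ, 0 ≤ κ ∧ SaturatingLawSup (d := Fin 3) (torusNegBotEigMoment 3) 3 2 κ) ∧
    (NegBotEigHeatCoercivePos (d := Fin 3) 4 →
      ∃ κ : ℝ, 0 ≤ κ ∧ SaturatingLawSup (d := Fin 3) (torusNegBotEigMoment 4) 5 (9 / 5) κ) := by
  refine ⟨fun h => ?_, fun h => ?_, fun h => ?_⟩
  · have h2 := negBotEigMoment_saturatingLawSup_of_heatCoercivePos (q := 2) (by norm_num) h
    norm_num at h2; exact h2
  · have h3 := negBotEigMoment_saturatingLawSup_of_heatCoercivePos (q := 3) (by norm_num) h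
    norm_num at h3; exact h3
  · have h4 := negBotEigMoment_saturatingLawSup_of_heatCoercivePos (q := 4) (by norm_num) h
    norm_num at h4; exact h4

end Summit.NavierStokesRegularity.FunctionalMining

end
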